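import Literature.AlgebraicGeometry.Limits.GenericFibreSpread
import Mathlib.RingTheory.DedekindDomain.Factorization
import Mathlib.AlgebraicGeometry.Noetherian
import HarnessLib

/-!
# A constructible set with empty generic fibre over a Dedekind base lies over finitely many primes
# ([EGA IV₃] 9.2; [Stacks 054J, 00FE]; [Görtz–Wedhorn I] Prop. 10.14)

Topic `Literature/AlgebraicGeometry/Limits`; namespace `Literature.AlgebraicGeometry.Limits`.  THEOREMS ONLY (no definition, no named fact, no
instance, no notation, no `sorry`; one `private` copy of the folklore «finite type over a Noetherian base ⇒ finite presentation»).  Cell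
`hodgecm-mathlib` (D-0151), FLOOR 0, P6 «MOD programme» (crux hLiu418 = stmt-HodgeConjecture-24832, `--supports`, count-neutral): organ **SP3-b
«CONSTRUCTIBLE, EMPTY GENERIC FIBRE ⇒ OVER FINITELY MANY PRIMES»** (GEN census `CENSUS-RGD-ASSEMBLY.v1` 09be7b9d row SP3-b; desk F0P6a-plan (g1) CUT MEMO
SP3-a2 b690d375 §(b)(d); consumer: the `ModuliDatum` field `inj₀` — the iso-locus of two pulled-back universal tuples over `W = (𝓜 ×_{S₀} 𝓜) ∖ Δ` is the
image of finitely many finite-type `W`-schemes (SP3-a2 `exists_isomPieces_finiteType`), has no point over the generic point of `Spec 𝒪_{Fᵢ}[1∕m]` (field-point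
fine moduli), hence lies over a FINITE set of primes, which GEN adds to `S_M`).  Part (b) «image of finite presentation is constructible» is Mathlib's
Chevalley `Scheme.Hom.isConstructible_image` (stacks 054J) and is merely re-exported in the shapes the consumer holds; part (d) is ★
`exists_basicOpen_disjoint_of_isConstructible` («misses the generic point ⇒ misses some `D(b)`, `b ≠ 0`») + «`V(b)` is finite in a Dedekind domain»
(Mathlib `Ideal.finite_factors`).  HC_CM is proved only modulo the printed citations until rung 0 closes; this file is generic and changes no count.

THE MATHEMATICS.  [EGAIV3] (9.2.1)–(9.2.3) ∕ [StacksProject, Tag 054J]: for `f : X → S` of finite presentation and `Z ⊆ X` constructible, `f(Z)` is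
constructible; [StacksProject, Tag 00FE] ∕ [GortzWedhorn2020] Prop. 10.14: a constructible subset of an irreducible Noetherian scheme not containing the
generic point is nowhere dense, i.e. contained in a proper closed subset — over `Spec B`, `B` a domain, in some `V(b)`, `b ≠ 0` (★ `GenericFibreSpread`);
and for a DEDEKIND domain `V(b) = {𝔭 ∣ (b)}` is finite ([Neukirch1999] Ch. I (3.3); Mathlib `Ideal.finite_factors`).  Over a field-valued point
`φ : B → k` the fibre of `Z` is then empty as soon as `ker φ` avoids that finite set.

* §1 (`Spec B`, `B` Dedekind) `finite_setOf_mem_asIdeal_primeSpectrum` (`V(b)` finite for `b ≠ 0`), **`finite_of_isConstructible_of_bot_notMem`** (constructible and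
  missing the generic point ⇒ finite), `exists_finset_of_isConstructible_of_bot_notMem`.
* §2 (schemes over `Spec B`) **`finite_image_of_isConstructible_of_bot_notMem`** (`f` of finite presentation, `Z ⊆ X` constructible, generic fibre of `Z`
  empty ⇒ `f(Z)` finite), the finite-type-over-Noetherian costume `finite_image_of_isConstructible_of_bot_notMem_of_finiteType`, the union form for
  finitely many pieces `finite_iUnion_range_of_bot_notMem` (SP3-a2's `∐ I i → T` output), and the field-point reading
  `preimage_eq_empty_of_notMem_image` (the fibre over `φ : B → k` misses `Z` whenever `ker φ ∉ f(Z)`).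

## References
* [EGAIV3] A. Grothendieck, J. Dieudonné, *Éléments de géométrie algébrique IV₃*, Publ. Math. IHÉS 28 (1966), (9.2.1)–(9.2.3).
* [StacksProject] The Stacks Project, Tags 054J (Chevalley), 00FE.
* [GortzWedhorn2020] U. Görtz, T. Wedhorn, *Algebraic Geometry I* (2nd ed. 2020), Proposition 10.14 and Section (10.7).
* [Neukirch1999] J. Neukirch, *Algebraic Number Theory* (1999), Ch. I (3.3).
-/

set_option autoImplicit false

noncomputable section

universe u

open CategoryTheory CategoryTheory.Limits AlgebraicGeometry TopologicalSpace Topology PrimeSpectrum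

namespace Literature.AlgebraicGeometry.Limits

/-! ## §1 `Spec B`, `B` a Dedekind domain -/

section Dedekind

variable {B : Type u} [CommRing B] [IsDedekindDomain B]

/-- **`V(b)` IS FINITE** for `b ≠ 0` in a Dedekind domain: the primes containing `b` are `⊥`-free and divide `(b)`, and `(b) ≠ 0` has finitely many prime
factors (Mathlib `Ideal.finite_factors`). [cite: Neukirch1999, Ch. I (3.3)] -/
theorem finite_setOf_mem_asIdeal_primeSpectrum {b : B} (hb : b ≠ 0) : {p : PrimeSpectrum B | b ∈ p.asIdeal}.Finite := by
  have hI : Ideal.span {b} ≠ (0 : Ideal B) := by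
    rw [Ne, Ideal.zero_eq_bot, Ideal.span_singleton_eq_bot]
    exact hb
  have hfin := Ideal.finite_factors hI
  -- inject `{p | b ∈ p}` into the finite set of height-one primes dividing `(b)`, via `asIdeal`
  have hsub : {p : PrimeSpectrum B | b ∈ p.asIdeal} ⊆
      PrimeSpectrum.asIdeal ⁻¹' (IsDedekindDomain.HeightOneSpectrum.asIdeal '' {v | v.asIdeal ∣ Ideal.span {b}}) := by
    intro p hp
    have hp0 : p.asIdeal ≠ ⊥ := fun h => hb (by simpa [h] using hp)
    refine ⟨⟨p.asIdeal, p.isPrime, hp0⟩, ?_, rfl⟩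
    change (⟨p.asIdeal, p.isPrime, hp0⟩ : IsDedekindDomain.HeightOneSpectrum B).asIdeal ∣ Ideal.span {b}
    rw [Ideal.dvd_iff_le, Ideal.span_singleton_le_iff_mem]
    exact hp
  refine Set.Finite.subset (Set.Finite.preimage (fun _ _ _ _ h => PrimeSpectrum.ext h) (hfin.image _)) hsub

/-- **A CONSTRUCTIBLE SUBSET OF `Spec B` (`B` DEDEKIND) NOT CONTAINING THE GENERIC POINT IS FINITE**: it misses some `D(b)` with `b ≠ 0` (★
`exists_basicOpen_disjoint_of_isConstructible`), so it lies in the finite `V(b)`. [cite: StacksProject, Tag 00FE] [cite: GortzWedhorn2020, Proposition 10.14]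
[cite: Neukirch1999, Ch. I (3.3)] -/
theorem finite_of_isConstructible_of_bot_notMem {s : Set (PrimeSpectrum B)} (hs : IsConstructible s) (h0 : (⊥ : PrimeSpectrum B) ∉ s) :
    s.Finite := by
  obtain ⟨b, hb, hdisj⟩ := exists_basicOpen_disjoint_of_isConstructible hs h0
  refine (finite_setOf_mem_asIdeal_primeSpectrum hb).subset fun p hp => ?_
  by_contra hbp
  exact Set.disjoint_left.mp hdisj ((mem_basicOpen b p).mpr hbp) hp

/-- Finset form: a constructible subset of `Spec B` missing the generic point is contained in a FINITE SET of primes.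
[cite: StacksProject, Tag 00FE] [cite: Neukirch1999, Ch. I (3.3)] -/
theorem exists_finset_of_isConstructible_of_bot_notMem {s : Set (PrimeSpectrum B)} (hs : IsConstructible s) (h0 : (⊥ : PrimeSpectrum B) ∉ s) :
    ∃ S : Finset (PrimeSpectrum B), s ⊆ ↑S :=
  ⟨(finite_of_isConstructible_of_bot_notMem hs h0).toFinset, fun p hp => by simpa using hp⟩

end Dedekind

/-! ## §2 Schemes over `Spec B`: constructible with empty generic fibre ⇒ over finitely many primes -/

section Scheme

variable {B : Type u} [CommRing B] [IsDedekindDomain B] {X : Scheme.{u}}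

/-- Over a locally Noetherian base, locally of finite type implies locally of finite presentation (Mathlib `RingHom.FinitePresentation.of_finiteType`
chart by chart); a local copy of the folklore lemma. [folklore] -/
private theorem locallyOfFinitePresentation_of_isLocallyNoetherian {Y : Scheme.{u}} (g : X ⟶ Y) [IsLocallyNoetherian Y] [LocallyOfFiniteType g] :
    LocallyOfFinitePresentation g := by
  rw [HasRingHomProperty.iff_appLE (P := @LocallyOfFinitePresentation)]
  intro U V e
  haveI := IsLocallyNoetherian.component_noetherian (X := Y) U
  exact RingHom.FinitePresentation.of_finiteType.mp (HasRingHomProperty.appLE @LocallyOfFiniteType g inferInstance U V e)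

/-- **CONSTRUCTIBLE, EMPTY GENERIC FIBRE ⇒ OVER FINITELY MANY PRIMES.**  `f : X → Spec B` of finite presentation (locally of finite presentation and
quasi-compact) over a Dedekind domain, `Z ⊆ X` constructible whose image misses the generic point (`Z` has no point over `(0)`): then `f(Z)` is a FINITE
set of primes (Chevalley: `f(Z)` is constructible, Mathlib `Scheme.Hom.isConstructible_image`; then §1). [cite: EGAIV3, (9.2.1)–(9.2.3)]
[cite: StacksProject, Tag 054J] [cite: Neukirch1999, Ch. I (3.3)] -/
theorem finite_image_of_isConstructible_of_bot_notMem (f : X ⟶ Spec (CommRingCat.of B)) [LocallyOfFinitePresentation f] [QuasiCompact f]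
    {Z : Set X} (hZ : IsConstructible Z) (h0 : (⊥ : PrimeSpectrum B) ∉ f '' Z) : (f '' Z).Finite :=
  finite_of_isConstructible_of_bot_notMem (f.isConstructible_image hZ) h0

/-- The FINITE-TYPE costume (the base `Spec B` is Noetherian, so finite type ⇒ finite presentation). [cite: EGAIV3, (9.2.1)–(9.2.3)] [cite: StacksProject, Tag 054J] -/
theorem finite_image_of_isConstructible_of_bot_notMem_of_finiteType (f : X ⟶ Spec (CommRingCat.of B)) [LocallyOfFiniteType f] [QuasiCompact f]
    {Z : Set X} (hZ : IsConstructible Z) (h0 : (⊥ : PrimeSpectrum B) ∉ f '' Z) : (f '' Z).Finite := by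
  haveI : IsNoetherianRing B := inferInstance
  haveI : IsLocallyNoetherian (Spec (CommRingCat.of B)) := inferInstance
  haveI := locallyOfFinitePresentation_of_isLocallyNoetherian f
  exact finite_image_of_isConstructible_of_bot_notMem f hZ h0

/-- **UNION FORM for finitely many finite-type pieces** (SP3-a2's output `∐ I i → T`): if `mᵢ : I i → Spec B` (`i ∈ ι`, finite) are of finite type and
quasi-compact and NO piece has a point over the generic point, the union of their images is a finite set of primes. [cite: EGAIV3, (9.2.1)–(9.2.3)]
[cite: StacksProject, Tag 054J] [cite: Neukirch1999, Ch. I (3.3)] -/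
theorem finite_iUnion_range_of_bot_notMem {ι : Type*} [Finite ι] (I : ι → Scheme.{u}) (m : ∀ i, I i ⟶ Spec (CommRingCat.of B))
    [∀ i, LocallyOfFiniteType (m i)] [∀ i, QuasiCompact (m i)] (h0 : ∀ i, (⊥ : PrimeSpectrum B) ∉ Set.range (m i)) :
    (⋃ i, Set.range (m i)).Finite := by
  refine Set.finite_iUnion fun i => ?_
  rw [← Set.image_univ]
  exact finite_image_of_isConstructible_of_bot_notMem_of_finiteType (m i) IsConstructible.univ (by rw [Set.image_univ]; exact h0 i)

omit [IsDedekindDomain B] in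
/-- **FIELD-POINT READING**: if `f(Z)` is finite (e.g. by the theorems above) then at every field-valued point `φ : B → k` whose kernel is NOT one of the
finitely many primes in `f(Z)`, the fibre `X ×_{Spec B} Spec k` misses `Z`. [cite: EGAIV3, (9.2.1)–(9.2.3)] [cite: GortzWedhorn2020, Section (10.7)] -/
theorem preimage_eq_empty_of_notMem_image (f : X ⟶ Spec (CommRingCat.of B)) {Z : Set X} {k : Type u} [Field k] (φ : B →+* k)
    (hφ : (⟨RingHom.ker φ, RingHom.ker_isPrime φ⟩ : PrimeSpectrum B) ∉ f '' Z) :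
    (pullback.fst f (Spec.map (CommRingCat.ofHom φ))) ⁻¹' Z = ∅ := by
  ext z
  simp only [Set.mem_preimage, Set.mem_empty_iff_false, iff_false]
  intro hz
  apply hφ
  refine ⟨_, hz, ?_⟩
  -- the image of `z` in `Spec B` is the image of the unique point of `Spec k`, i.e. `ker φ`
  have h1 : f (pullback.fst f (Spec.map (CommRingCat.ofHom φ)) z) =
      Spec.map (CommRingCat.ofHom φ) (pullback.snd f (Spec.map (CommRingCat.ofHom φ)) z) := by
    rw [← Scheme.Hom.comp_apply, ← Scheme.Hom.comp_apply, pullback.condition]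
  rw [h1]
  have h2 : pullback.snd f (Spec.map (CommRingCat.ofHom φ)) z = (⊥ : PrimeSpectrum k) := Subsingleton.elim _ _
  rw [h2]
  apply PrimeSpectrum.ext
  change Ideal.comap (CommRingCat.ofHom φ).hom ⊥ = RingHom.ker φ
  rw [← RingHom.ker_eq_comap_bot]
  rfl

end Scheme

end Literature.AlgebraicGeometry.Limits

end
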